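import Mathlib
import HarnessLib

/-!
# Clock consequences of a PERIODIC readout: discrete self-similarity in an arbitrary clock is
# discrete self-similarity in Leray's clock — no logarithmic (or any secular) gauge correction

Summit `NavierStokesRegularity`, cell topic directory `FluidComputer`, namespace
`…FluidComputer.SelfSimilarCensus` (kernel side of zone Z7 of the D-0081 profile search, «generalised
self-similar with logarithmic correction (DSS / log-periodic ansatz)»). Pure real analysis; the
companion file `PeriodicProfileClockRigidity.lean` feeds it from the Navier–Stokes / Euler momentum
equation. PROVED theorems only; no definitions, no named facts. Twin (DSS side) of
`ModulatedCollapseGaugeRigidity.lean` (steady profile in any clock ⇒ Leray's clock exactly).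

## Setting (similarity time `σ` is the primary variable, so that no inverse function is needed)

A CLOCK is a pair of real functions on a half-line `σ ≥ σ₀`: the velocity scale `ℓ(σ) > 0`
(differentiable, derivative `ℓ′`) and the physical time `θ(σ)` with `θ′(σ) = ℓ(σ)⁻²` — the
definition of similarity time for the scale `ℓ` (Leray: `ℓ = (2a(T−t))^{-1/2}`, `σ = −(2a)⁻¹ log(T−t)`,
readout `ℓ′/ℓ ≡ ½` for `a = ½`). The READOUT is `b := ℓ′/ℓ = (log ℓ)′`. Hypothesis of this file:
`b` is `P`-PERIODIC on the half-line, `b(σ + P) = b(σ)` — which is what the momentum equation forces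
on a `P`-periodic profile (`PeriodicProfileClockRigidity.lean`).

## Content

* `hasDerivAt_periodRatio`, `periodRatio_eq`, `exists_scaleFactor`: the period ratio `ℓ(σ+P)/ℓ(σ)` has
  derivative `0`, so `ℓ(σ + P) = c·ℓ(σ)` for ONE constant `c > 0`; `log_scaleFactor_eq_integral`:
  `log c = ∫_σ^{σ+P} b` (the period MEAN of the readout is `log c / P`; compare the Leray-clock
  identity `…Theorems.ModulationReadout.periodMean_readout_eq_half`, where `P = 2 log c`).
* `hasDerivAt_periodDefect`, `exists_periodShift`: `θ(σ + P) = θ(σ)/c² + d` for one constant `d`.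
* `strictMonoOn_time`: `θ` is strictly increasing.
* BLOW-UP BRANCH (`θ → T` as `σ → ∞`, i.e. the clock's physical time range is bounded — the only branch
  a blow-up candidate can live on): `periodShift_eq_of_tendsto` (`d = T − T/c²`, so
  `T − θ(σ+P) = (T − θ(σ))/c²`), `time_lt_blowupTime`, `one_lt_scaleFactor` (`c > 1`: BACKWARD DSS),
  `sub_time_mul_sq_add_period` (`(T − θ)·ℓ²` is `P`-periodic) and `exists_bounds_sub_time_mul_sq`
  (`0 < m ≤ (T − θ(σ))·ℓ(σ)² ≤ M` on the whole half-line): the velocity scale is Leray's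
  `(T − t)^{-1/2}` up to a factor that is PERIODIC in similarity time and bounded away from `0` and `∞`
  — a «logarithmic correction» `(−log(T−t))^β`, `β ≠ 0`, or any other secular correction, is
  impossible. (For `c = 1` the clock is time-periodic with `θ → +∞`; for `c < 1` it is a forward /
  expanding DSS clock; neither is a blow-up clock — `one_lt_scaleFactor`.)

Elementary (quotient rule, `constant_of_has_deriv_right_zero`, a compactness argument on one period);
nothing here uses an equation; nothing is a statement about Navier–Stokes. WHAT THIS IS NOT: not NS —
bookkeeping for the gauge of a hypothetical exactly discretely self-similar object; «violates:» none.

## References (context only; every statement below is folklore real analysis)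

* J. Leray, Acta Math. 63 (1934) 193–248, §20, (3.11)–(3.12). [Leray1934]
* D. Chae, J. Wolf, Arch. Rational Mech. Anal. 225 (2017), Def. 1.1 and §4 (DSS ⇔ periodic profile in
  Leray's similarity time; tree `Literature.Analysis.FluidPDE.periodic_lerayOrbit_iff`). [ChaeWolf2017RemovingDSS]
-/

noncomputable section

open Set Filter Topology

namespace Summit.NavierStokesRegularity.FluidComputer.SelfSimilarCensus

/-! ### §1 Periodic readout ⇒ one scale factor per period: `ℓ(σ + P) = c·ℓ(σ)` -/

section ScaleRatio

variable {ℓ ℓ' : ℝ → ℝ} {σ₀ P : ℝ}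

/-- **Quotient rule for the period ratio.** If `ℓ` is differentiable at `σ` and at `σ + P`,
non-vanishing there, and the readout `ℓ′/ℓ` takes the same value at `σ` and `σ + P`, then
`s ↦ ℓ(s + P)/ℓ(s)` has derivative `0` at `σ`. [folklore] -/
theorem hasDerivAt_periodRatio {σ : ℝ} (h1 : HasDerivAt ℓ (ℓ' σ) σ)
    (h2 : HasDerivAt ℓ (ℓ' (σ + P)) (σ + P)) (hne : ℓ σ ≠ 0) (hne' : ℓ (σ + P) ≠ 0)
    (hb : ℓ' (σ + P) / ℓ (σ + P) = ℓ' σ / ℓ σ) :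
    HasDerivAt (fun s => ℓ (s + P) / ℓ s) 0 σ := by
  have h2' : HasDerivAt (fun s => ℓ (s + P)) (ℓ' (σ + P)) σ := h2.comp_add_const σ P
  have h := h2'.div h1 hne
  refine h.congr_deriv ?_
  rw [div_eq_div_iff hne' hne] at hb
  have hnum : ℓ' (σ + P) * ℓ σ - ℓ (σ + P) * ℓ' σ = 0 := by linear_combination hb
  rw [hnum, zero_div]

/-- **The period ratio is constant on the half-line.** If for every `σ ≥ σ₀` the scale `ℓ` is
differentiable and non-vanishing and the readout satisfies `(ℓ′/ℓ)(σ + P) = (ℓ′/ℓ)(σ)` (`P ≥ 0`), then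
`ℓ(σ + P)/ℓ(σ) = ℓ(σ₀ + P)/ℓ(σ₀)` for every `σ ≥ σ₀`. [folklore] -/
theorem periodRatio_eq (hP : 0 ≤ P) (hℓ : ∀ σ, σ₀ ≤ σ → HasDerivAt ℓ (ℓ' σ) σ)
    (hne : ∀ σ, σ₀ ≤ σ → ℓ σ ≠ 0)
    (hb : ∀ σ, σ₀ ≤ σ → ℓ' (σ + P) / ℓ (σ + P) = ℓ' σ / ℓ σ) {σ : ℝ} (hσ : σ₀ ≤ σ) :
    ℓ (σ + P) / ℓ σ = ℓ (σ₀ + P) / ℓ σ₀ := by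
  have hD : ∀ s, σ₀ ≤ s → HasDerivAt (fun s => ℓ (s + P) / ℓ s) 0 s := fun s hs =>
    hasDerivAt_periodRatio (hℓ s hs) (hℓ (s + P) (by linarith)) (hne s hs) (hne (s + P) (by linarith))
      (hb s hs)
  have hcont : ContinuousOn (fun s => ℓ (s + P) / ℓ s) (Icc σ₀ σ) :=
    fun s hs => ((hD s hs.1).continuousAt).continuousWithinAt
  have hder : ∀ s ∈ Ico σ₀ σ, HasDerivWithinAt (fun s => ℓ (s + P) / ℓ s) 0 (Ici s) s :=
    fun s hs => (hD s hs.1).hasDerivWithinAt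
  exact constant_of_has_deriv_right_zero hcont hder σ (right_mem_Icc.2 hσ)

/-- **One scale factor per period.** Under the hypotheses of `periodRatio_eq` with `ℓ > 0` on the
half-line there is ONE constant `c > 0` with `ℓ(σ + P) = c·ℓ(σ)` for every `σ ≥ σ₀`. [folklore] -/
theorem exists_scaleFactor (hP : 0 ≤ P) (hℓ : ∀ σ, σ₀ ≤ σ → HasDerivAt ℓ (ℓ' σ) σ)
    (hpos : ∀ σ, σ₀ ≤ σ → 0 < ℓ σ)
    (hb : ∀ σ, σ₀ ≤ σ → ℓ' (σ + P) / ℓ (σ + P) = ℓ' σ / ℓ σ) :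
    ∃ c : ℝ, 0 < c ∧ ∀ σ, σ₀ ≤ σ → ℓ (σ + P) = c * ℓ σ := by
  have hne : ∀ σ, σ₀ ≤ σ → ℓ σ ≠ 0 := fun σ hσ => (hpos σ hσ).ne'
  refine ⟨ℓ (σ₀ + P) / ℓ σ₀, div_pos (hpos _ (by linarith)) (hpos _ le_rfl), fun σ hσ => ?_⟩
  rw [← periodRatio_eq hP hℓ hne hb hσ, div_mul_cancel₀ _ (hne σ hσ)]

/-- **The scale factor is the exponential of the period integral of the readout**:
`log c = ∫_σ^{σ+P} ℓ′/ℓ` whenever `ℓ(σ + P) = c·ℓ(σ)`, `ℓ > 0` is differentiable on `[σ, σ + P]`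
(`P ≥ 0`) and `ℓ′` is continuous there — so the period MEAN of the readout is `log c / P` (in Leray's
own similarity time `P = 2 log c` and the mean is `½`). [folklore] -/
theorem log_scaleFactor_eq_integral {σ c : ℝ} (hP : 0 ≤ P)
    (hℓ : ∀ s ∈ Icc σ (σ + P), HasDerivAt ℓ (ℓ' s) s) (hpos : ∀ s ∈ Icc σ (σ + P), 0 < ℓ s)
    (hcont : ContinuousOn ℓ' (Icc σ (σ + P))) (hc : ℓ (σ + P) = c * ℓ σ) :
    Real.log c = ∫ s in σ..(σ + P), ℓ' s / ℓ s := by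
  have hσP : σ ≤ σ + P := by linarith
  have hℓσ : 0 < ℓ σ := hpos σ (left_mem_Icc.2 hσP)
  have hcpos : 0 < c := by
    have h1 := hpos (σ + P) (right_mem_Icc.2 hσP)
    rw [hc] at h1
    nlinarith
  have hderiv : ∀ s ∈ uIcc σ (σ + P), HasDerivAt (fun s => Real.log (ℓ s)) (ℓ' s / ℓ s) s := by
    intro s hs
    rw [uIcc_of_le hσP] at hs
    exact (hℓ s hs).log (hpos s hs).ne'
  have hcontq : ContinuousOn (fun s => ℓ' s / ℓ s) (uIcc σ (σ + P)) := by
    rw [uIcc_of_le hσP]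
    exact hcont.div (fun s hs => (hℓ s hs).continuousAt.continuousWithinAt) fun s hs => (hpos s hs).ne'
  rw [intervalIntegral.integral_eq_sub_of_hasDerivAt hderiv (hcontq.intervalIntegrable), hc,
    Real.log_mul hcpos.ne' hℓσ.ne', add_sub_cancel_right]

end ScaleRatio

/-! ### §2 The physical time of the clock: `θ(σ + P) = θ(σ)/c² + d`, and `θ` is increasing -/

section TimeMap

variable {ℓ θ : ℝ → ℝ} {σ₀ P c : ℝ}

/-- **The period defect of the physical time has derivative zero**: with `θ′ = ℓ⁻²` at `σ` and at
`σ + P` and `ℓ(σ + P) = c·ℓ(σ)` (`c ≠ 0`, `ℓ(σ) ≠ 0`), `s ↦ θ(s + P) − θ(s)/c²` has derivative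
`(c ℓ)⁻² − ℓ⁻²/c² = 0` at `σ`. [folklore] -/
theorem hasDerivAt_periodDefect {σ : ℝ} (h1 : HasDerivAt θ ((ℓ σ ^ 2)⁻¹) σ)
    (h2 : HasDerivAt θ ((ℓ (σ + P) ^ 2)⁻¹) (σ + P)) (hc : ℓ (σ + P) = c * ℓ σ) (hc0 : c ≠ 0)
    (hne : ℓ σ ≠ 0) : HasDerivAt (fun s => θ (s + P) - θ s / c ^ 2) 0 σ := by
  have h2' : HasDerivAt (fun s => θ (s + P)) ((ℓ (σ + P) ^ 2)⁻¹) σ := h2.comp_add_const σ P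
  have h := h2'.sub (h1.div_const (c ^ 2))
  refine h.congr_deriv ?_
  rw [hc]
  field_simp
  ring

/-- **One period shift of the physical time.** If on the half-line `σ ≥ σ₀` the clock has
`θ′ = ℓ⁻²`, `ℓ ≠ 0`, and `ℓ(σ + P) = c·ℓ(σ)` (`P ≥ 0`, `c ≠ 0`), then there is ONE constant `d`
with `θ(σ + P) = θ(σ)/c² + d` for every `σ ≥ σ₀`. [folklore] -/
theorem exists_periodShift (hP : 0 ≤ P) (hθ : ∀ σ, σ₀ ≤ σ → HasDerivAt θ ((ℓ σ ^ 2)⁻¹) σ)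
    (hne : ∀ σ, σ₀ ≤ σ → ℓ σ ≠ 0) (hc0 : c ≠ 0) (hc : ∀ σ, σ₀ ≤ σ → ℓ (σ + P) = c * ℓ σ) :
    ∃ d : ℝ, ∀ σ, σ₀ ≤ σ → θ (σ + P) = θ σ / c ^ 2 + d := by
  have hD : ∀ s, σ₀ ≤ s → HasDerivAt (fun s => θ (s + P) - θ s / c ^ 2) 0 s := fun s hs =>
    hasDerivAt_periodDefect (hθ s hs) (hθ (s + P) (by linarith)) (hc s hs) hc0 (hne s hs)
  refine ⟨θ (σ₀ + P) - θ σ₀ / c ^ 2, fun σ hσ => ?_⟩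
  have hcont : ContinuousOn (fun s => θ (s + P) - θ s / c ^ 2) (Icc σ₀ σ) :=
    fun s hs => ((hD s hs.1).continuousAt).continuousWithinAt
  have hder : ∀ s ∈ Ico σ₀ σ, HasDerivWithinAt (fun s => θ (s + P) - θ s / c ^ 2) 0 (Ici s) s :=
    fun s hs => (hD s hs.1).hasDerivWithinAt
  have key := constant_of_has_deriv_right_zero hcont hder σ (right_mem_Icc.2 hσ)
  -- `key : θ (σ + P) - θ σ / c ^ 2 = θ (σ₀ + P) - θ σ₀ / c ^ 2`
  linarith

/-- **Physical time is strictly increasing in similarity time**: `θ′ = ℓ⁻² > 0` on the half-line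
`σ ≥ σ₀` (`ℓ ≠ 0`). [folklore] -/
theorem strictMonoOn_time (hθ : ∀ σ, σ₀ ≤ σ → HasDerivAt θ ((ℓ σ ^ 2)⁻¹) σ)
    (hne : ∀ σ, σ₀ ≤ σ → ℓ σ ≠ 0) : StrictMonoOn θ (Ici σ₀) := by
  refine strictMonoOn_of_deriv_pos (convex_Ici σ₀)
    (fun s hs => ((hθ s hs).continuousAt).continuousWithinAt) fun s hs => ?_
  rw [interior_Ici] at hs
  rw [(hθ s (le_of_lt hs)).deriv]
  have := hne s (le_of_lt hs)
  positivity

end TimeMap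

/-! ### §3 The blow-up branch: bounded physical time forces `c > 1`, the blow-up time `T` is the
fixed point of the period shift, and `(T − θ)·ℓ²` is periodic — Leray's gauge up to a bounded
periodic factor -/

section Blowup

variable {ℓ θ : ℝ → ℝ} {σ₀ P c d T : ℝ}

/-- **The limit pins the shift.** If `θ(σ + P) = θ(σ)/c² + d` for `σ ≥ σ₀` and `θ(σ) → T` as
`σ → ∞`, then `d = T − T/c²`, i.e. `T − θ(σ + P) = (T − θ(σ))/c²` for every `σ ≥ σ₀`: the period
shift is the homothety of ratio `c⁻²` about `T`. [folklore] -/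
theorem periodShift_eq_of_tendsto (hd : ∀ σ, σ₀ ≤ σ → θ (σ + P) = θ σ / c ^ 2 + d)
    (hT : Tendsto θ atTop (𝓝 T)) {σ : ℝ} (hσ : σ₀ ≤ σ) :
    T - θ (σ + P) = (T - θ σ) / c ^ 2 := by
  have h1 : Tendsto (fun s => θ (s + P)) atTop (𝓝 T) := hT.comp (tendsto_atTop_add_const_right _ P tendsto_id)
  have h2 : Tendsto (fun s => θ s / c ^ 2 + d) atTop (𝓝 (T / c ^ 2 + d)) :=
    (hT.div_const _).add_const d
  have h3 : Tendsto (fun s => θ (s + P)) atTop (𝓝 (T / c ^ 2 + d)) := by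
    refine h2.congr' ?_
    filter_upwards [eventually_ge_atTop σ₀] with s hs
    exact (hd s hs).symm
  have hTd : T = T / c ^ 2 + d := tendsto_nhds_unique h1 h3
  rw [hd σ hσ, sub_div]
  linarith

/-- **The clock's physical time stays before the blow-up time**: a strictly increasing `θ` on
`σ ≥ σ₀` converging to `T` has `θ(σ) < T` for every `σ ≥ σ₀` (`P > 0` is used to step once
forward). [folklore] -/
theorem time_lt_blowupTime (hP : 0 < P) (hmono : StrictMonoOn θ (Ici σ₀))
    (hT : Tendsto θ atTop (𝓝 T)) {σ : ℝ} (hσ : σ₀ ≤ σ) : θ σ < T := by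
  have hle : θ (σ + P) ≤ T := by
    refine ge_of_tendsto hT ?_
    filter_upwards [eventually_ge_atTop (σ + P)] with s hs
    exact hmono.monotoneOn (show σ + P ∈ Ici σ₀ by simp only [mem_Ici]; linarith)
      (show s ∈ Ici σ₀ by simp only [mem_Ici]; linarith) hs
  have hlt : θ σ < θ (σ + P) :=
    hmono (show σ ∈ Ici σ₀ from hσ) (show σ + P ∈ Ici σ₀ by simp only [mem_Ici]; linarith)
      (by linarith)
  exact lt_of_lt_of_le hlt hle

/-- **Bounded physical time ⇒ BACKWARD discrete self-similarity (`c > 1`).** If on `σ ≥ σ₀` the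
clock is strictly increasing with `θ → T`, `ℓ(σ + P) = c·ℓ(σ)` with `c > 0`, and
`θ(σ + P) = θ(σ)/c² + d` (`P > 0`), then `1 < c`. (So `c = 1` — a time-periodic clock — and
`c < 1` — a forward / expanding DSS clock — have UNBOUNDED physical time: no blow-up.) [folklore] -/
theorem one_lt_scaleFactor (hP : 0 < P) (hmono : StrictMonoOn θ (Ici σ₀)) (hc : 0 < c)
    (hd : ∀ σ, σ₀ ≤ σ → θ (σ + P) = θ σ / c ^ 2 + d) (hT : Tendsto θ atTop (𝓝 T)) : 1 < c := by
  have hA : 0 < T - θ σ₀ := sub_pos.2 (time_lt_blowupTime hP hmono hT le_rfl)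
  have hB : T - θ (σ₀ + P) = (T - θ σ₀) / c ^ 2 := periodShift_eq_of_tendsto hd hT le_rfl
  have hlt : θ σ₀ < θ (σ₀ + P) :=
    hmono (show σ₀ ∈ Ici σ₀ from self_mem_Ici) (show σ₀ + P ∈ Ici σ₀ by simp only [mem_Ici]; linarith)
      (by linarith)
  have hBA : (T - θ σ₀) / c ^ 2 < T - θ σ₀ := by rw [← hB]; linarith
  have hc2 : 1 < c ^ 2 := by
    by_contra h
    push Not at h
    have : T - θ σ₀ ≤ (T - θ σ₀) / c ^ 2 := by
      rw [le_div_iff₀ (by positivity)]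
      nlinarith
    linarith
  nlinarith

/-- **`(T − θ)·ℓ²` is `P`-periodic** under `ℓ(σ + P) = c·ℓ(σ)` and `T − θ(σ + P) = (T − θ(σ))/c²`
(`c ≠ 0`): the «modulation relative to Leray», remaining time × squared velocity scale, takes the same
value one period later. [folklore] -/
theorem sub_time_mul_sq_add_period {σ : ℝ} (hc0 : c ≠ 0) (hc : ℓ (σ + P) = c * ℓ σ)
    (hfix : T - θ (σ + P) = (T - θ σ) / c ^ 2) :
    (T - θ (σ + P)) * ℓ (σ + P) ^ 2 = (T - θ σ) * ℓ σ ^ 2 := by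
  rw [hfix, hc]
  field_simp

/-- Iterating a half-line periodicity: if `f(s + P) = f(s)` for all `s ≥ σ₀` (`P ≥ 0`) then
`f(s + n·P) = f(s)` for all `n : ℕ` and `s ≥ σ₀`. [folklore] -/
theorem apply_add_nat_mul_eq_of_periodic {f : ℝ → ℝ} (hP : 0 ≤ P)
    (hf : ∀ s, σ₀ ≤ s → f (s + P) = f s) (n : ℕ) {s : ℝ} (hs : σ₀ ≤ s) :
    f (s + n * P) = f s := by
  induction n with
  | zero => simp
  | succ n ih =>
    have hsn : σ₀ ≤ s + n * P := by
      have : (0 : ℝ) ≤ n * P := mul_nonneg (Nat.cast_nonneg n) hP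
      linarith
    rw [Nat.cast_succ, add_mul, one_mul, ← add_assoc, hf _ hsn, ih]

/-- **A continuous half-line-periodic function is squeezed between its extrema over one period.**
If `f` is continuous on `σ ≥ σ₀` and `f(s + P) = f(s)` there (`P > 0`), then there are `m ≤ M`,
both VALUES of `f` on `[σ₀, σ₀ + P]`, with `m ≤ f(s) ≤ M` for all `s ≥ σ₀`. [folklore] -/
theorem exists_bounds_of_periodic {f : ℝ → ℝ} (hP : 0 < P) (hcont : ContinuousOn f (Ici σ₀))
    (hf : ∀ s, σ₀ ≤ s → f (s + P) = f s) :
    ∃ a ∈ Icc σ₀ (σ₀ + P), ∃ b ∈ Icc σ₀ (σ₀ + P), ∀ s, σ₀ ≤ s → f a ≤ f s ∧ f s ≤ f b := by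
  have hK : IsCompact (Icc σ₀ (σ₀ + P)) := isCompact_Icc
  have hne : (Icc σ₀ (σ₀ + P)).Nonempty := nonempty_Icc.2 (by linarith)
  have hcK : ContinuousOn f (Icc σ₀ (σ₀ + P)) := hcont.mono fun s hs => hs.1
  obtain ⟨a, ha, hmin⟩ := hK.exists_isMinOn hne hcK
  obtain ⟨b, hb, hmax⟩ := hK.exists_isMaxOn hne hcK
  refine ⟨a, ha, b, hb, fun s hs => ?_⟩
  -- reduce `s` into the fundamental period
  set n : ℕ := ⌊(s - σ₀) / P⌋₊ with hn
  have hq : 0 ≤ (s - σ₀) / P := div_nonneg (by linarith) hP.le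
  have h1 : (n : ℝ) ≤ (s - σ₀) / P := Nat.floor_le hq
  have h2 : (s - σ₀) / P < n + 1 := Nat.lt_floor_add_one _
  have h1' : (n : ℝ) * P ≤ s - σ₀ := by rwa [le_div_iff₀ hP] at h1
  have h2' : s - σ₀ < (n + 1) * P := by rwa [div_lt_iff₀ hP] at h2
  set s' := s - n * P with hs'
  have hs'mem : s' ∈ Icc σ₀ (σ₀ + P) := ⟨by linarith, by nlinarith⟩
  have hper : f s = f s' := by
    have := apply_add_nat_mul_eq_of_periodic hP.le hf n hs'mem.1
    rw [show s' + n * P = s by rw [hs']; ring] at this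
    exact this
  rw [hper]
  exact ⟨hmin hs'mem, hmax hs'mem⟩

/-- **NO SECULAR CORRECTION TO LERAY'S GAUGE.** On the half-line `σ ≥ σ₀` let the clock satisfy:
`ℓ > 0` differentiable, `θ′ = ℓ⁻²`, `ℓ(σ + P) = c·ℓ(σ)` (`c > 0`, `P > 0`),
`T − θ(σ + P) = (T − θ(σ))/c²`, and `θ(σ) < T`. Then there are constants `0 < m ≤ M` with
`m ≤ (T − θ(σ))·ℓ(σ)² ≤ M` for EVERY `σ ≥ σ₀`: in physical time, `m/(T − t) ≤ ℓ² ≤ M/(T − t)` —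
the velocity scale is `(T − t)^{-1/2}` up to a bounded factor, periodic in similarity time; a factor
`(−log(T − t))^{β}` with `β ≠ 0` (or any factor tending to `0` or `∞`) is excluded. [folklore] -/
theorem exists_bounds_sub_time_mul_sq (hP : 0 < P) (hc : 0 < c)
    (hℓd : ∀ σ, σ₀ ≤ σ → DifferentiableAt ℝ ℓ σ) (hpos : ∀ σ, σ₀ ≤ σ → 0 < ℓ σ)
    (hθ : ∀ σ, σ₀ ≤ σ → HasDerivAt θ ((ℓ σ ^ 2)⁻¹) σ)
    (hcl : ∀ σ, σ₀ ≤ σ → ℓ (σ + P) = c * ℓ σ)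
    (hfix : ∀ σ, σ₀ ≤ σ → T - θ (σ + P) = (T - θ σ) / c ^ 2) (hlt : ∀ σ, σ₀ ≤ σ → θ σ < T) :
    ∃ m M : ℝ, 0 < m ∧ m ≤ M ∧
      ∀ σ, σ₀ ≤ σ → m ≤ (T - θ σ) * ℓ σ ^ 2 ∧ (T - θ σ) * ℓ σ ^ 2 ≤ M := by
  set f : ℝ → ℝ := fun s => (T - θ s) * ℓ s ^ 2 with hf
  have hcont : ContinuousOn f (Ici σ₀) := by
    intro s hs
    have h1 : ContinuousAt θ s := (hθ s hs).continuousAt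
    have h2 : ContinuousAt ℓ s := (hℓd s hs).continuousAt
    exact ((continuousAt_const.sub h1).mul (h2.pow 2)).continuousWithinAt
  have hper : ∀ s, σ₀ ≤ s → f (s + P) = f s := fun s hs =>
    sub_time_mul_sq_add_period hc.ne' (hcl s hs) (hfix s hs)
  obtain ⟨a, ha, b, hb, hab⟩ := exists_bounds_of_periodic hP hcont hper
  have hfa : 0 < f a := mul_pos (sub_pos.2 (hlt a ha.1)) (pow_pos (hpos a ha.1) 2)
  exact ⟨f a, f b, hfa, (hab a ha.1).2, fun σ hσ => hab σ hσ⟩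

end Blowup

end Summit.NavierStokesRegularity.FluidComputer.SelfSimilarCensus

end
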